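import Literature.NumberTheory.LFunctions.WeilSemilocalCompactnessProofs
import Literature.NumberTheory.LFunctions.WeilWindowSuzukiContinuityProofs
import Literature.NumberTheory.LFunctions.WeilArchimedeanMoments
import HarnessLib

/-!
# Stub `stub_logPlancherel` of the line `Sketch` (crux `WeilGroundState.GroundStatesConvergeToXi`,
item stmt-RiemannHypothesis-1527, rev L9)

**The log-weighted Plancherel integral is form-bounded on a window.**  For `0 < a` there are
constants `A, B ≥ 0` such that for every test function `g` with `tsupport g ⊆ [-a, a]`
the function `t ↦ ‖ĝ(1/2 + it)‖² log(|t| + 2)` is integrable and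
`∫ ‖ĝ(1/2 + it)‖² log(|t| + 2) dt ≤ A · Re Q(g) + B · ‖g‖₂²`.

Proof outline.
* Integrability: `0 ≤ log(|t| + 2) ≤ |t| + 1 ≤ 2 + t²`, a weight of quadratic growth, so
  `integrable_norm_sq_weilMellin_mul` (decay `‖ĝ(1/2+it)‖ = O((1+t²)⁻¹)`) applies.
* The archimedean weight `ρ(t) = Re ψ(1/4 + it/2) = reDigammaQuarter t` satisfies
  `|ρ(t) − log(1 + |t|/2)| ≤ C` (`exists_abs_reDigammaQuarter_sub_log_le`), hence pointwise
  `log(|t| + 2) = log 2 + log(1 + |t|/2) ≤ ρ(t) + C + log 2` and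
  `‖ĝ‖² log(|t|+2) ≤ ‖ĝ‖² ρ(t) + (C + log 2) ‖ĝ‖²`.
* Integrating (`integral_mono`), Plancherel `∫ ‖ĝ(1/2+it)‖² = 2π ‖g‖₂²`
  (`integral_norm_sq_weilMellin_half_line`) and the boundedness of the polar and prime parts of
  Weil's form on the window, `(1/2π) ∫ ‖ĝ‖² ρ ≤ Re Q(g) + K(a) ‖g‖₂²`
  (`weilArchIntegral_le_weilQuadratic_re`, `K(a) = 2(sinh a − a) + 2 Σ_{n ≤ e^{2a}} Λ(n)/√n + log π ≥ 0`)
  give the claim with `A = 2π`, `B = 2π (K(a) + C + log 2)`.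
-/

set_option linter.dupNamespace false

noncomputable section

open MeasureTheory Complex Filter Set
open scoped Real Topology ComplexConjugate ArithmeticFunction.vonMangoldt

namespace Summit.RiemannHypothesis.RiemannHypothesis.Theorems.GroundStatesConvergeToXi

open Literature.NumberTheory.LFunctions Literature.Analysis.SpecialFunctions

/-- The logarithmic weight has quadratic growth: `|log(|t| + 2)| ≤ 2 + 1 · t²`. [folklore] -/
theorem logPlancherel_abs_log_le (t : ℝ) : |Real.log (|t| + 2)| ≤ 2 + 1 * t ^ 2 := by
  have h0 : 0 ≤ Real.log (|t| + 2) := Real.log_nonneg (by linarith [abs_nonneg t])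
  have h1 : Real.log (|t| + 2) ≤ |t| + 2 - 1 :=
    Real.log_le_sub_one_of_pos (by linarith [abs_nonneg t])
  rw [abs_of_nonneg h0]
  nlinarith [sq_abs t, sq_nonneg (|t| - 1), abs_nonneg t]

/-- `t ↦ ‖ĝ(1/2 + it)‖² log(|t| + 2)` is integrable for every test function `g`
(decay `‖ĝ(1/2+it)‖ = O((1+t²)⁻¹)` against a weight of quadratic growth). [folklore] -/
theorem logPlancherel_integrable {g : ℝ → ℂ} (hg : IsWeilTest g) :
    Integrable (fun t : ℝ => ‖weilMellin g (1 / 2 + t * I)‖ ^ 2 * Real.log (|t| + 2)) :=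
  integrable_norm_sq_weilMellin_mul hg (F := fun t : ℝ => Real.log (|t| + 2))
    (Real.measurable_log.comp (by fun_prop)) (A := 2) (B := 1) (by norm_num) (by norm_num)
    logPlancherel_abs_log_le

/-- The logarithmic weight is dominated by the archimedean weight up to a constant:
there is `C ≥ 0` with `log(|t| + 2) ≤ Re ψ(1/4 + it/2) + C` for all `t`
(`Re ψ(1/4 + it/2) = log(1 + |t|/2) + O(1)` and `log(|t|+2) = log 2 + log(1 + |t|/2)`). [folklore] -/
theorem logPlancherel_exists_log_le_reDigammaQuarter_add :
    ∃ C : ℝ, 0 ≤ C ∧ ∀ t : ℝ, Real.log (|t| + 2) ≤ reDigammaQuarter t + C := by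
  obtain ⟨C, hC⟩ := exists_abs_reDigammaQuarter_sub_log_le
  have hC0 : 0 ≤ C := (abs_nonneg _).trans (hC 0)
  have hlog2 : 0 ≤ Real.log 2 := Real.log_nonneg (by norm_num)
  refine ⟨C + Real.log 2, by positivity, fun t => ?_⟩
  have ht : 0 < 1 + |t| / 2 := by positivity
  have hsplit : Real.log (|t| + 2) = Real.log 2 + Real.log (1 + |t| / 2) := by
    rw [← Real.log_mul two_ne_zero ht.ne']
    congr 1
    ring
  have h := (abs_le.1 (hC t)).1
  rw [hsplit]
  linarith

/-- **Stub `stub_logPlancherel` (W9, RH-free): the log-weighted Plancherel integral is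
form-bounded on a window.**  For `0 < a` there are `A, B ≥ 0` with
`∫ ‖ĝ(1/2+it)‖² log(|t|+2) dt ≤ A · Re Q(g) + B · ‖g‖₂²` for all test functions `g` supported in
`[-a, a]` (and the integrand is integrable): the archimedean weight of Weil's form is
`Re ψ(1/4 + it/2) = log(1 + |t|/2) + O(1)`, the polar and prime parts are bounded on the window
(`weilArchIntegral_le_weilQuadratic_re`), and `∫ ‖ĝ(1/2+it)‖² = 2π ‖g‖₂²` (Plancherel). [folklore] -/
theorem stub_logPlancherel :
    ∀ a : ℝ, 0 < a → ∃ A B : ℝ, 0 ≤ A ∧ 0 ≤ B ∧ ∀ g : ℝ → ℂ, IsWeilTest g →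
      tsupport g ⊆ Icc (-a) a →
        Integrable (fun t : ℝ => ‖weilMellin g (1 / 2 + t * I)‖ ^ 2 * Real.log (|t| + 2)) ∧
        ∫ t : ℝ, ‖weilMellin g (1 / 2 + t * I)‖ ^ 2 * Real.log (|t| + 2) ≤
          A * (weilQuadratic g).re + B * ∫ t : ℝ, ‖g t‖ ^ 2 := by
  intro a ha
  obtain ⟨C, hC0, hC⟩ := logPlancherel_exists_log_le_reDigammaQuarter_add
  -- the window constant of `weilArchIntegral_le_weilQuadratic_re`
  set K : ℝ := 2 * (Real.sinh a - a)
      + 2 * (∑ n ∈ Finset.range (⌊Real.exp (2 * a)⌋₊ + 1), (Λ n : ℝ) / Real.sqrt n)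
      + Real.log π with hK
  have hK0 : 0 ≤ K := by
    have h1 : a ≤ Real.sinh a := Real.self_le_sinh_iff.2 ha.le
    have h2 : 0 ≤ ∑ n ∈ Finset.range (⌊Real.exp (2 * a)⌋₊ + 1), (Λ n : ℝ) / Real.sqrt n :=
      Finset.sum_nonneg fun n _ =>
        div_nonneg ArithmeticFunction.vonMangoldt_nonneg (Real.sqrt_nonneg _)
    have h3 : 0 ≤ Real.log π := Real.log_nonneg (by linarith [Real.pi_gt_three])
    rw [hK]
    nlinarith
  have h2pi : (0 : ℝ) < 2 * π := by positivity
  refine ⟨2 * π, 2 * π * (K + C), h2pi.le, by positivity, fun g hg hsupp => ?_⟩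
  have hint_log := logPlancherel_integrable hg
  refine ⟨hint_log, ?_⟩
  set N2 : ℝ := ∫ t : ℝ, ‖g t‖ ^ 2 with hN2
  have hN2_0 : 0 ≤ N2 := integral_nonneg fun _ => by positivity
  have hint_rho := integrable_norm_sq_weilMellin_mul_reDigammaQuarter hg
  have hint_sq := integrable_norm_sq_weilMellin_half_line hg
  -- pointwise comparison of the weights
  have hpt : ∀ t : ℝ, ‖weilMellin g (1 / 2 + t * I)‖ ^ 2 * Real.log (|t| + 2) ≤
      ‖weilMellin g (1 / 2 + t * I)‖ ^ 2 * reDigammaQuarter t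
        + C * ‖weilMellin g (1 / 2 + t * I)‖ ^ 2 := by
    intro t
    have h := mul_le_mul_of_nonneg_left (hC t) (sq_nonneg ‖weilMellin g (1 / 2 + t * I)‖)
    linarith
  have hint_rhs : Integrable (fun t : ℝ => ‖weilMellin g (1 / 2 + t * I)‖ ^ 2 * reDigammaQuarter t
      + C * ‖weilMellin g (1 / 2 + t * I)‖ ^ 2) := hint_rho.add (hint_sq.const_mul C)
  have hmono := integral_mono hint_log hint_rhs hpt
  rw [integral_add hint_rho (hint_sq.const_mul C), integral_const_mul,
    integral_norm_sq_weilMellin_half_line hg] at hmono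
  -- the archimedean integral is form-bounded on the window
  have harch : ∫ t : ℝ, ‖weilMellin g (1 / 2 + t * I)‖ ^ 2 * reDigammaQuarter t ≤
      2 * π * ((weilQuadratic g).re + K * N2) := by
    have h := weilArchIntegral_le_weilQuadratic_re hg hsupp
    rw [← hK, ← hN2] at h
    have h' := mul_le_mul_of_nonneg_left h h2pi.le
    rwa [← mul_assoc, mul_one_div_cancel h2pi.ne', one_mul] at h'
  have hw : weilNorm2Sq g = N2 := rfl
  rw [hw] at hmono
  have hCN : 0 ≤ C * (2 * π * N2) := by positivity
  nlinarith [hmono, harch, hCN]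

end Summit.RiemannHypothesis.RiemannHypothesis.Theorems.GroundStatesConvergeToXi
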